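import Literature.Analysis.FluidPDE.WeakDerivAlong
import Literature.Analysis.FunctionSpaces.WeakCompactnessLpFinite
import Literature.Analysis.FunctionSpaces.SobolevTraceDensityHigherProofs
import Literature.Analysis.FunctionSpaces.MeyersSerrinProofs
import HarnessLib

/-!
# Translates and difference quotients of Sobolev functions on a pair of open sets
# (Nirenberg's method of difference quotients: the analytic toolkit)

Topic `Analysis/FunctionSpaces`. Theorem-only support file (one auxiliary definition with its
unfolding lemma, no named facts) for the boundary regularity theory of weak solutions of
divergence-form elliptic equations (L. C. Evans, *PDE*, §5.8.2 and §6.3; M. E. Taylor, *PDE I*, Ch. 5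
§1 and §7), in the setting of the tree's Sobolev classes `HasWeakFDerivOn` / `MemSobolevDomain`
(`SobolevDomain.lean`). Throughout, `Ω' ⊆ Ω` are open sets of a finite-dimensional real inner product
space, `μ` is an additive Haar measure, `v` a vector and `t` a real number such that the translate
`Ω' + t v` stays inside `Ω` (for a half-ball and a direction tangent to its flat face this is the
situation of boundary regularity; for concentric balls, interior regularity):

* `diffQuot v t f y = t⁻¹ • (f (y + t • v) - f y)` — the difference quotient
  (Evans §5.8.2, `D^h_i u`);
* translation: test functions, set integrals (`setIntegral_smul_comp_sub_eq`, the discrete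
  integration by parts `∫_Ω g(y) k(y - w) = ∫_Ω g(y + w) k(y)` under support hypotheses), weak
  derivatives (`HasWeakFDerivOn.comp_add`) and Sobolev membership (`MemSobolevDomain.comp_add`)
  pass from `Ω` to `Ω'` under `Ω' + w ⊆ Ω`; hence so do difference quotients
  (`HasWeakFDerivOn.diffQuot`, `MemSobolevDomain.diffQuot`);
* **Evans §5.8.2, Theorem 3 (i)**: `‖D^t_v f‖_{L^p(Ω')} ≤ ‖Df v‖_{L^p(Ω)}` for `f ∈ W^{1,p}(Ω)`,
  `1 ≤ p < ∞`, whenever the segments `[y, y + t v]`, `y ∈ Ω'`, lie in `Ω`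
  (`eLpNorm_diffQuot_le`: fundamental theorem of calculus and Jensen on `[0,1]` for functions
  smooth in `Ω`, Meyers–Serrin density `meyers_serrin_holds` to pass to `W^{1,p}`);
* **Evans §5.8.2, Theorem 3 (ii)**: if `‖D^{tₙ}_v w‖_{L²(Ω')} ≤ C` along a sequence `tₙ → 0`,
  `tₙ ≠ 0`, then `w` has a weak derivative along the constant field `v` on `Ω'` with
  `L²(Ω')`-norm `≤ C` (`exists_hasWeakDerivAlong_of_eLpNorm_diffQuot_le`: weak compactness in
  `L²(Ω')`, the tree's `exists_subseq_tendsto_integral_mul_of_lintegral_rpow_le'`, and the discrete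
  integration by parts against test functions).

## Mathlib / tree search

Tree: `HasWeakDerivAlong` (`FluidPDE/WeakDerivAlong.lean`; difference quotients along the
symmetries of the periodic cylinder, `PeriodicCylinderDifferenceQuotients.lean`, are specific to that
geometry and to `L²`-convergent quotients), `meyers_serrin_holds`, `eSobolevDomainNorm_succ_eq`,
`exists_subseq_tendsto_integral_mul_of_lintegral_rpow_le'` (`WeakCompactnessLpFinite.lean`),
`lintegral_enorm_translate_sub_rpow_le` (whole space, `SobolevDomainProofs.lean`). Mathlib:
`MeasureTheory.integral_add_right_eq_self`, `Measure.IsAddRightInvariant`, nothing on difference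
quotients of Sobolev functions (`lean search 'diffQuot|difference quotient'`).

## References

* L. C. Evans, *Partial Differential Equations*, 2nd ed. (2010), §5.8.2, Theorem 3 (difference
  quotients and weak derivatives); §6.3.1–§6.3.2 (their use). [Evans2010]
* L. Nirenberg, *Remarks on strongly elliptic partial differential equations*, Comm. Pure Appl.
  Math. 8 (1955) 649–675 (the method). [folklore]
* M. E. Taylor, *Partial Differential Equations I*, 2nd ed. (2011), Ch. 5, §1 (Lemma 1.4) and §7
  ((7.22)–(7.30)). [TaylorPDEI2011]
-/

noncomputable section

open MeasureTheory TopologicalSpace Set Function Filter Topology InnerProductSpace Metric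
open scoped RealInnerProductSpace ENNReal NNReal ContDiff

namespace Literature.Analysis.FunctionSpaces

open Literature.Analysis.FluidPDE SobolevApprox

variable {E : Type*} [NormedAddCommGroup E] [NormedSpace ℝ E]
variable {F : Type*} [NormedAddCommGroup F] [NormedSpace ℝ F]

/-! ### Difference quotients -/

/-- The **difference quotient** `D^t_v f (y) = t⁻¹ (f(y + t v) - f(y))` of `f` in the direction `v`
with step `t` (Evans, *PDE*, §5.8.2, `D^h_i u(x) = (u(x + h eᵢ) - u(x))/h`). [cite: Evans2010, §5.8.2] -/
def diffQuot (v : E) (t : ℝ) (f : E → F) (y : E) : F :=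
  t⁻¹ • (f (y + t • v) - f y)

/-- Unfolding lemma for `diffQuot`. [folklore] -/
theorem diffQuot_apply (v : E) (t : ℝ) (f : E → F) (y : E) :
    diffQuot v t f y = t⁻¹ • (f (y + t • v) - f y) := rfl

/-- `diffQuot` is additive in the function. [folklore] -/
theorem diffQuot_add (v : E) (t : ℝ) (f g : E → F) :
    diffQuot v t (f + g) = diffQuot v t f + diffQuot v t g := by
  funext y
  simp only [diffQuot, Pi.add_apply]
  rw [← smul_add]
  congr 1
  abel

/-- `diffQuot` is homogeneous in the function. [folklore] -/
theorem diffQuot_const_smul (v : E) (t : ℝ) (c : ℝ) (f : E → F) :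
    diffQuot v t (c • f) = c • diffQuot v t f := by
  funext y
  simp only [diffQuot, Pi.smul_apply, ← smul_sub, smul_comm c]

/-- `diffQuot` commutes with subtraction. [folklore] -/
theorem diffQuot_sub (v : E) (t : ℝ) (f g : E → F) :
    diffQuot v t (f - g) = diffQuot v t f - diffQuot v t g := by
  funext y
  simp only [diffQuot, Pi.sub_apply, ← smul_sub]
  congr 1
  abel

/-- Applying a continuous linear map valued difference quotient to a vector. [folklore] -/
theorem diffQuot_clm_apply {G : Type*} [NormedAddCommGroup G] [NormedSpace ℝ G] (v : E) (t : ℝ)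
    (f : E → E →L[ℝ] G) (y w : E) :
    diffQuot v t f y w = diffQuot v t (fun x => f x w) y := by
  simp only [diffQuot, FunLike.coe_smul, FunLike.coe_sub, Pi.smul_apply, Pi.sub_apply]

/-! ### Translation of test functions and of set integrals -/

section Translate

variable [MeasurableSpace E] [BorelSpace E] [FiniteDimensional ℝ E]

omit [MeasurableSpace E] [BorelSpace E] [FiniteDimensional ℝ E] in
/-- The translate `y ↦ φ (y - w)` of a test function on `Ω'` is a test function on `Ω` whenever
`Ω' + w ⊆ Ω` (Evans, *PDE*, §5.8.2, proof of Theorem 3). [folklore] -/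
theorem IsTestFunctionOn.comp_sub_const {Ω Ω' : Opens E} {φ : E → ℝ} (hφ : IsTestFunctionOn Ω' φ)
    {w : E} (hΩ : ∀ y ∈ (Ω' : Set E), y + w ∈ (Ω : Set E)) :
    IsTestFunctionOn Ω fun y => φ (y - w) := by
  refine ⟨hφ.contDiff.comp (contDiff_id.sub contDiff_const), ?_, ?_⟩
  · exact hφ.hasCompactSupport.comp_homeomorph (Homeomorph.subRight w)
  · intro y hy
    have hy' : y - w ∈ tsupport φ := by
      have := (tsupport_comp_subset_preimage φ (f := fun y : E => y - w)
        (Homeomorph.subRight w).continuous) hy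
      simpa using this
    have := hΩ (y - w) (hφ.tsupport_subset hy')
    simpa using this

omit [NormedSpace ℝ E] [FiniteDimensional ℝ E] in
/-- **Discrete integration by parts, change of variables half**: for a real weight `k` supported in
a set `A` with `A + w ⊆ S` and `A ⊆ T`, `∫_S k(y - w) • g(y) dμ = ∫_T k(y) • g(y + w) dμ` — both sides
are integrals over the whole space of translates of one function (Evans, *PDE*, §5.8.2, proof of
Theorem 3: "`∫_V u (D^{-h}_i φ) = -∫_V (D^h_i u) φ`"). No integrability is needed (both sides are
the same junk value otherwise). [cite: Evans2010, §5.8.2 proof of Theorem 3] -/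
theorem setIntegral_smul_comp_sub_eq (μ : Measure E) [μ.IsAddRightInvariant] {S T A : Set E}
    {k : E → ℝ} {g : E → F} {w : E} (hk : support k ⊆ A) (hAS : ∀ y ∈ A, y + w ∈ S)
    (hAT : A ⊆ T) :
    ∫ y in S, k (y - w) • g y ∂μ = ∫ y in T, k y • g (y + w) ∂μ := by
  -- both integrands vanish off the respective sets
  have h1 : ∫ y in S, k (y - w) • g y ∂μ = ∫ y, k (y - w) • g y ∂μ := by
    refine setIntegral_eq_integral_of_forall_compl_eq_zero fun y hy => ?_
    have : k (y - w) = 0 := by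
      by_contra hne
      have hyA : y - w ∈ A := hk (mem_support.2 hne)
      have := hAS _ hyA
      simp only [sub_add_cancel] at this
      exact hy this
    rw [this, zero_smul]
  have h2 : ∫ y in T, k y • g (y + w) ∂μ = ∫ y, k y • g (y + w) ∂μ := by
    refine setIntegral_eq_integral_of_forall_compl_eq_zero fun y hy => ?_
    have : k y = 0 := by
      by_contra hne
      exact hy (hAT (hk (mem_support.2 hne)))
    rw [this, zero_smul]
  rw [h1, h2]
  have := integral_add_right_eq_self (μ := μ) (fun y => k (y - w) • g y) w
  simp only [add_sub_cancel_right] at this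
  exact this.symm

omit [NormedSpace ℝ F] in
/-- The translate of a function locally integrable on `Ω` is locally integrable on `Ω'` when
`Ω' + w ⊆ Ω`. [folklore] -/
theorem locallyIntegrableOn_comp_add (μ : Measure E) [μ.IsAddRightInvariant] {Ω Ω' : Opens E}
    {f : E → F} (hf : LocallyIntegrableOn f (Ω : Set E) μ) {w : E}
    (hΩ : ∀ y ∈ (Ω' : Set E), y + w ∈ (Ω : Set E)) :
    LocallyIntegrableOn (fun y => f (y + w)) (Ω' : Set E) μ := by
  rw [locallyIntegrableOn_iff Ω'.isOpen.isLocallyClosed]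
  intro K hK hKc
  set e : E → E := fun y => y + w with he
  have himg : e '' K ⊆ (Ω : Set E) := by
    rintro _ ⟨y, hy, rfl⟩
    exact hΩ y (hK hy)
  have hi : IntegrableOn f (e '' K) μ :=
    hf.integrableOn_compact_subset himg (hKc.image (continuous_id.add continuous_const))
  have hpre : e ⁻¹' (e '' K) = K :=
    (add_left_injective w).preimage_image K
  have := ((measurePreserving_add_right μ w).integrableOn_comp_preimage
    (measurableEmbedding_addRight w) (f := f) (s := e '' K)).2 hi
  rwa [hpre] at this

omit [NormedSpace ℝ E] [NormedSpace ℝ F] [FiniteDimensional ℝ E] in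
/-- `L^p` norms of translates: `‖f(· + w)‖_{L^p(Ω')} ≤ ‖f‖_{L^p(Ω)}` when `Ω' + w ⊆ Ω`
(translation invariance of `μ` and monotonicity in the domain). [folklore] -/
theorem eLpNorm_comp_add_le (μ : Measure E) [μ.IsAddRightInvariant] {Ω Ω' : Opens E}
    (f : E → F) (p : ℝ≥0∞) {w : E} (hΩ : ∀ y ∈ (Ω' : Set E), y + w ∈ (Ω : Set E)) :
    eLpNorm (fun y => f (y + w)) p (μ.restrict (Ω' : Set E)) ≤ eLpNorm f p (μ.restrict (Ω : Set E)) := by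
  set e : E → E := fun y => y + w with he
  have himg : e '' (Ω' : Set E) ⊆ (Ω : Set E) := by
    rintro _ ⟨y, hy, rfl⟩
    exact hΩ y hy
  have hpre : e ⁻¹' (e '' (Ω' : Set E)) = (Ω' : Set E) :=
    (add_left_injective w).preimage_image _
  have hmp : MeasurePreserving e (μ.restrict (e ⁻¹' (e '' (Ω' : Set E))))
      (μ.restrict (e '' (Ω' : Set E))) :=
    (measurePreserving_add_right μ w).restrict_preimage_emb (measurableEmbedding_addRight w) _
  rw [hpre] at hmp
  have h1 : eLpNorm (fun y => f (y + w)) p (μ.restrict (Ω' : Set E)) =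
      eLpNorm f p (μ.restrict (e '' (Ω' : Set E))) := by
    rw [← hmp.map_eq, (measurableEmbedding_addRight w).eLpNorm_map_measure]
    rfl
  rw [h1]
  exact eLpNorm_mono_measure f (Measure.restrict_mono_set μ himg)

omit [NormedSpace ℝ E] [NormedSpace ℝ F] [FiniteDimensional ℝ E] in
/-- `L^p` membership of translates (translation invariance and monotonicity). [folklore] -/
theorem memLp_comp_add (μ : Measure E) [μ.IsAddRightInvariant] {Ω Ω' : Opens E}
    {f : E → F} {p : ℝ≥0∞} (hf : MemLp f p (μ.restrict (Ω : Set E))) {w : E}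
    (hΩ : ∀ y ∈ (Ω' : Set E), y + w ∈ (Ω : Set E)) :
    MemLp (fun y => f (y + w)) p (μ.restrict (Ω' : Set E)) := by
  set e : E → E := fun y => y + w with he
  have himg : e '' (Ω' : Set E) ⊆ (Ω : Set E) := by
    rintro _ ⟨y, hy, rfl⟩
    exact hΩ y hy
  have hpre : e ⁻¹' (e '' (Ω' : Set E)) = (Ω' : Set E) :=
    (add_left_injective w).preimage_image _
  have hmp : MeasurePreserving e (μ.restrict (e ⁻¹' (e '' (Ω' : Set E))))
      (μ.restrict (e '' (Ω' : Set E))) :=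
    (measurePreserving_add_right μ w).restrict_preimage_emb (measurableEmbedding_addRight w) _
  rw [hpre] at hmp
  exact (hf.mono_measure (Measure.restrict_mono_set μ himg)).comp_measurePreserving hmp

/-- **Weak derivatives translate**: if `g` is a weak derivative of `f` on `Ω` and `Ω' + w ⊆ Ω`, then
`g(· + w)` is a weak derivative of `f(· + w)` on `Ω'` (test the identity on `Ω` with the translated
test function; Evans, *PDE*, §5.8.2, proof of Theorem 3). [cite: Evans2010, §5.8.2 proof of Theorem 3] -/
theorem HasWeakFDerivOn.comp_add (μ : Measure E) [μ.IsAddRightInvariant] {Ω Ω' : Opens E}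
    {f : E → F} {g : E → E →L[ℝ] F} (h : HasWeakFDerivOn Ω μ f g) {w : E}
    (hΩ : ∀ y ∈ (Ω' : Set E), y + w ∈ (Ω : Set E)) :
    HasWeakFDerivOn Ω' μ (fun y => f (y + w)) (fun y => g (y + w)) where
  locallyIntegrableOn := locallyIntegrableOn_comp_add μ h.locallyIntegrableOn hΩ
  locallyIntegrableOn_deriv := locallyIntegrableOn_comp_add μ h.locallyIntegrableOn_deriv hΩ
  integral_fderiv_smul_eq φ v hφ := by
    -- test the identity on `Ω` with `ψ = φ (· - w)`
    have hψ : IsTestFunctionOn Ω fun y => φ (y - w) := hφ.comp_sub_const hΩ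
    have key := h.integral_fderiv_smul_eq (fun y => φ (y - w)) v hψ
    have hDψ : ∀ y, fderiv ℝ (fun y => φ (y - w)) y v = fderiv ℝ φ (y - w) v := fun y => by
      rw [fderiv_comp_sub]
    simp_rw [hDψ] at key
    -- move both integrals to `Ω'` by the change of variables `y ↦ y + w`
    have hA : tsupport φ ⊆ (Ω' : Set E) := hφ.tsupport_subset
    have hAw : ∀ y ∈ tsupport φ, y + w ∈ (Ω : Set E) := fun y hy => hΩ y (hA hy)
    have hk1 : support (fun y => fderiv ℝ φ y v) ⊆ tsupport φ :=
      (subset_tsupport _).trans (tsupport_fderiv_apply_subset ℝ v)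
    have e1 := setIntegral_smul_comp_sub_eq μ (k := fun y => fderiv ℝ φ y v) (g := f) hk1 hAw hA
    have e2 := setIntegral_smul_comp_sub_eq μ (k := φ) (g := fun y => g y v) (subset_tsupport φ)
      hAw hA
    rw [← e1, ← e2]
    exact key

/-- **Sobolev functions translate**: `f ∈ W^{k,p}(Ω)` and `Ω' + w ⊆ Ω` give `f(· + w) ∈ W^{k,p}(Ω')`
(Evans, *PDE*, §5.8.2). [cite: Evans2010, §5.8.2] -/
theorem MemSobolevDomain.comp_add (μ : Measure E) [μ.IsAddRightInvariant] {Ω Ω' : Opens E} {k : ℕ}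
    {p : ℝ≥0∞} :
    ∀ {f : E → F}, MemSobolevDomain k p Ω μ f → ∀ {w : E},
      (∀ y ∈ (Ω' : Set E), y + w ∈ (Ω : Set E)) →
        MemSobolevDomain k p Ω' μ (fun y => f (y + w)) := by
  induction k generalizing Ω Ω' with
  | zero =>
    intro f hf w hΩ
    rw [memSobolevDomain_zero_iff] at hf ⊢
    exact memLp_comp_add μ hf hΩ
  | succ k ih =>
    intro f hf w hΩ
    obtain ⟨h0, g, hg, hgk⟩ := hf
    exact ⟨memLp_comp_add μ h0 hΩ, fun y => g (y + w), hg.comp_add μ hΩ, fun v =>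
      ih (Ω := Ω) (Ω' := Ω') (hgk v) hΩ⟩

/-! ### Difference quotients of Sobolev functions -/

/-- **The weak derivative of a difference quotient is the difference quotient of the weak
derivative**: for `Ω' ⊆ Ω` with `Ω' + t v ⊆ Ω` (Evans, *PDE*, §5.8.2, proof of Theorem 3 and
§6.3.1, proof of Theorem 1: "`D(D^h_k u) = D^h_k (Du)`"). [cite: Evans2010, §6.3.1 proof of Theorem 1] -/
theorem HasWeakFDerivOn.diffQuot (μ : Measure E) [μ.IsAddRightInvariant] {Ω Ω' : Opens E}
    {f : E → F} {g : E → E →L[ℝ] F} (h : HasWeakFDerivOn Ω μ f g) (hle : Ω' ≤ Ω) {v : E}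
    {t : ℝ} (hΩ : ∀ y ∈ (Ω' : Set E), y + t • v ∈ (Ω : Set E)) :
    HasWeakFDerivOn Ω' μ (diffQuot v t f) (diffQuot v t g) := by
  have h1 : HasWeakFDerivOn Ω' μ (fun y => f (y + t • v)) (fun y => g (y + t • v)) :=
    h.comp_add μ hΩ
  have h2 : HasWeakFDerivOn Ω' μ f g := HasWeakFDerivOn.mono_set_holds h hle
  have h3 := (h1.sub h2).const_smul t⁻¹
  have ef : FunctionSpaces.diffQuot v t f = t⁻¹ • ((fun y => f (y + t • v)) - f) := by
    funext y; simp [FunctionSpaces.diffQuot]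
  have eg : FunctionSpaces.diffQuot v t g = t⁻¹ • ((fun y => g (y + t • v)) - g) := by
    funext y; simp [FunctionSpaces.diffQuot]
  rw [ef, eg]
  exact h3

/-- Difference quotients of `W^{k,p}(Ω)` functions lie in `W^{k,p}(Ω')` for `Ω' ⊆ Ω` with
`Ω' + t v ⊆ Ω` (Evans, *PDE*, §5.8.2). [cite: Evans2010, §5.8.2] -/
theorem MemSobolevDomain.diffQuot (μ : Measure E) [μ.IsAddRightInvariant] {Ω Ω' : Opens E}
    {k : ℕ} {p : ℝ≥0∞} {f : E → F} (hf : MemSobolevDomain k p Ω μ f) (hle : Ω' ≤ Ω) {v : E}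
    {t : ℝ} (hΩ : ∀ y ∈ (Ω' : Set E), y + t • v ∈ (Ω : Set E)) :
    MemSobolevDomain k p Ω' μ (diffQuot v t f) := by
  have h1 : MemSobolevDomain k p Ω' μ (fun y => f (y + t • v)) := hf.comp_add μ hΩ
  have h2 : MemSobolevDomain k p Ω' μ f := MemSobolevDomain.mono_set_holds hf hle
  have h3 := memSobolevDomain_sub h1 h2
  have e : FunctionSpaces.diffQuot v t f = t⁻¹ • ((fun y => f (y + t • v)) - f) := by
    funext y; simp [FunctionSpaces.diffQuot]
  rw [e]
  exact h3.const_smul t⁻¹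

omit [FiniteDimensional ℝ E] in
/-- **Discrete integration by parts** (Evans, *PDE*, §5.8.2, proof of Theorem 3 (ii), and §6.3.1,
proof of Theorem 1, (19): "`∫_V u D^{-h}_k φ dx = -∫_V (D^h_k u) φ dx`"): for a real weight `k`
with `supp k ⊆ A ⊆ Ω`, `A + t v ⊆ Ω` and `A - t v ⊆ Ω`,
`∫_Ω (D^{-t}_v k) • g dμ = -∫_Ω k • (D^t_v g) dμ`, provided `k • g` is integrable on `Ω`.
[cite: Evans2010, §5.8.2 proof of Theorem 3] -/
theorem setIntegral_diffQuot_neg_smul_eq (μ : Measure E) [μ.IsAddRightInvariant] {Ω : Opens E}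
    {A : Set E} {k : E → ℝ} {g : E → F} {v : E} {t : ℝ} (hk : support k ⊆ A)
    (hA : A ⊆ (Ω : Set E)) (hAp : ∀ y ∈ A, y + t • v ∈ (Ω : Set E))
    (hint : IntegrableOn (fun y => k y • g y) (Ω : Set E) μ)
    (hint' : IntegrableOn (fun y => k y • g (y + t • v)) (Ω : Set E) μ) :
    ∫ y in (Ω : Set E), (diffQuot v (-t) k y) • g y ∂μ =
      -∫ y in (Ω : Set E), k y • diffQuot v t g y ∂μ := by
  have hshift : ∫ y in (Ω : Set E), k (y - t • v) • g y ∂μ =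
      ∫ y in (Ω : Set E), k y • g (y + t • v) ∂μ :=
    setIntegral_smul_comp_sub_eq μ hk hAp hA
  have e1 : ∀ y, (diffQuot v (-t) k y) • g y = (-t)⁻¹ • (k (y - t • v) • g y - k y • g y) :=
    fun y => by
      rw [diffQuot, smul_eq_mul, mul_smul, sub_smul, show y + -t • v = y - t • v by
        rw [neg_smul, sub_eq_add_neg]]
  have e2 : ∀ y, k y • diffQuot v t g y = t⁻¹ • (k y • g (y + t • v) - k y • g y) := fun y => by
    rw [diffQuot, smul_comm (k y) t⁻¹, smul_sub]
  simp_rw [e1, e2]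
  have hint'' : IntegrableOn (fun y => k (y - t • v) • g y) (Ω : Set E) μ := by
    have hsupp : support (fun y => k y • g (y + t • v)) ⊆ (Ω : Set E) := by
      intro y hy
      apply hA; apply hk
      rw [mem_support] at hy ⊢
      exact fun h0 => hy (by rw [h0, zero_smul])
    have hI : Integrable (fun y => k y • g (y + t • v)) μ :=
      (integrableOn_iff_integrable_of_support_subset hsupp).1 hint'
    have := hI.comp_sub_right (t • v)
    simp only [sub_add_cancel] at this
    exact this.integrableOn
  rw [integral_smul, integral_smul, integral_sub hint'' hint, integral_sub hint' hint, hshift, inv_neg,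
    neg_smul]

end Translate


/-! ### `‖D^t_v f‖_{L^p(Ω')} ≤ ‖∂_v f‖_{L^p(Ω)}` (Evans §5.8.2, Theorem 3 (i)) -/

section Bound

variable [MeasurableSpace E] [BorelSpace E] [FiniteDimensional ℝ E]

omit [NormedSpace ℝ E] [FiniteDimensional ℝ E] in
/-- Monotone translation of set `lintegral`s: `∫_{Ω'} h(y + w) dμ ≤ ∫_Ω h dμ` for `Ω' + w ⊆ Ω`.
[folklore] -/
theorem setLIntegral_comp_add_le (μ : Measure E) [μ.IsAddRightInvariant] {Ω Ω' : Set E}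
    (hΩ' : MeasurableSet Ω') {w : E} (hΩ : ∀ y ∈ Ω', y + w ∈ Ω) (h : E → ℝ≥0∞) :
    ∫⁻ y in Ω', h (y + w) ∂μ ≤ ∫⁻ y in Ω, h y ∂μ := by
  calc ∫⁻ y in Ω', h (y + w) ∂μ = ∫⁻ y, Ω'.indicator (fun y => h (y + w)) y ∂μ :=
        (lintegral_indicator hΩ' _).symm
    _ ≤ ∫⁻ y, Ω.indicator h (y + w) ∂μ := by
        refine lintegral_mono fun y => ?_
        by_cases hy : y ∈ Ω'
        · rw [indicator_of_mem hy, indicator_of_mem (hΩ y hy)]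
        · rw [indicator_of_notMem hy]; exact bot_le
    _ = ∫⁻ y, Ω.indicator h y ∂μ := lintegral_add_right_eq_self _ w
    _ ≤ ∫⁻ y in Ω, h y ∂μ := lintegral_indicator_le _ _

variable [CompleteSpace F]

omit [MeasurableSpace E] [BorelSpace E] [FiniteDimensional ℝ E] in
/-- Pointwise fundamental-theorem-of-calculus bound for the difference quotient of a function `C¹`
on the open set `Ω`, along a segment `[y, y + t v] ⊆ Ω`:
`‖D^t_v φ (y)‖ ≤ ∫₀¹ ‖Dφ(y + s t v) v‖ ds` (Evans, *PDE*, §5.8.2, proof of Theorem 3 (i):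
"`u(x + h eᵢ) - u(x) = h ∫₀¹ u_{xᵢ}(x + s h eᵢ) ds`"). [cite: Evans2010, §5.8.2 proof of Theorem 3 (i)] -/
theorem enorm_diffQuot_le_lintegral {Ω : Set E} (hΩo : IsOpen Ω) {φ : E → F} (hφ : ContDiffOn ℝ 1 φ Ω) {v : E} {t : ℝ} {y : E}
    (hseg : ∀ s ∈ Icc (0:ℝ) 1, y + (s * t) • v ∈ Ω) :
    ‖FunctionSpaces.diffQuot v t φ y‖ₑ ≤ ∫⁻ s in Ioc (0:ℝ) 1, ‖fderiv ℝ φ (y + (s * t) • v) v‖ₑ := by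
  by_cases ht : t = 0
  · simp [FunctionSpaces.diffQuot, ht]
  set G : ℝ → F := fun s => φ (y + (s * t) • v) with hG
  set G' : ℝ → F := fun s => fderiv ℝ φ (y + (s * t) • v) (t • v) with hG'
  have hd : ∀ s ∈ Icc (0:ℝ) 1, DifferentiableAt ℝ φ (y + (s * t) • v) := fun s hs =>
    (hφ.differentiableOn one_ne_zero).differentiableAt (hΩo.mem_nhds (hseg s hs))
  have hderiv : ∀ s ∈ Set.uIcc (0:ℝ) 1, HasDerivAt G (G' s) s := by
    intro s hs
    rw [Set.uIcc_of_le zero_le_one] at hs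
    have h1 : HasDerivAt (fun s : ℝ => y + (s * t) • v) (t • v) s := by
      have := ((hasDerivAt_id s).mul_const t).smul_const v
      simpa using this.const_add y
    exact (hd s hs).hasFDerivAt.comp_hasDerivAt s h1
  have hcont : ContinuousOn G' (Set.uIcc (0:ℝ) 1) := by
    rw [Set.uIcc_of_le zero_le_one]
    have hpath : Continuous fun s : ℝ => y + (s * t) • v := by fun_prop
    have hmaps : MapsTo (fun s : ℝ => y + (s * t) • v) (Icc (0:ℝ) 1) Ω := fun s hs => hseg s hs
    have hDc : ContinuousOn (fderiv ℝ φ) Ω := hφ.continuousOn_fderiv_of_isOpen hΩo le_rfl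
    exact ((hDc.comp hpath.continuousOn hmaps).clm_apply continuousOn_const)
  have hftc : ∫ s in (0:ℝ)..1, G' s = φ (y + t • v) - φ y := by
    have := intervalIntegral.integral_eq_sub_of_hasDerivAt hderiv (hcont.intervalIntegrable)
    simpa [G] using this
  have hrepr : FunctionSpaces.diffQuot v t φ y =
      ∫ s in (0:ℝ)..1, fderiv ℝ φ (y + (s * t) • v) v := by
    rw [FunctionSpaces.diffQuot, ← hftc]
    have e : ∀ s, G' s = t • fderiv ℝ φ (y + (s * t) • v) v := fun s => by
      simp only [hG', map_smul]
    simp_rw [e]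
    rw [intervalIntegral.integral_smul, inv_smul_smul₀ ht]
  rw [hrepr, intervalIntegral.integral_of_le zero_le_one]
  exact enorm_integral_le_lintegral_enorm _

omit [FiniteDimensional ℝ E] in
/-- **The smooth case of Evans §5.8.2, Theorem 3 (i)**: for `φ` of class `C¹` on `Ω` and a pair
`Ω' ⊆ Ω` such that the segments `[y, y + t v]`, `y ∈ Ω'`, lie in `Ω`, and `1 ≤ q < ∞`,
`∫_{Ω'} ‖D^t_v φ‖^q dμ ≤ ∫_Ω ‖Dφ v‖^q dμ` (FTC, Jensen on `[0,1]`, Tonelli, translation).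
[cite: Evans2010, §5.8.2 Theorem 3 (i)] -/
theorem lintegral_enorm_diffQuot_rpow_le_of_contDiffOn (μ : Measure E) [μ.IsAddRightInvariant]
    [SFinite μ] {Ω Ω' : Opens E} {φ : E → F} (hφ : ContDiffOn ℝ 1 φ (Ω : Set E)) {v : E} {t : ℝ}
    (hseg : ∀ y ∈ (Ω' : Set E), ∀ s ∈ Icc (0:ℝ) 1, y + (s * t) • v ∈ (Ω : Set E)) {q : ℝ}
    (hq : 1 ≤ q) :
    ∫⁻ y in (Ω' : Set E), ‖FunctionSpaces.diffQuot v t φ y‖ₑ ^ q ∂μ ≤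
      ∫⁻ y in (Ω : Set E), ‖fderiv ℝ φ y v‖ₑ ^ q ∂μ := by
  have hq0 : 0 ≤ q := by linarith
  set ν : Measure ℝ := volume.restrict (Ioc (0:ℝ) 1) with hν
  haveI : IsProbabilityMeasure ν := ⟨by simp [ν]⟩
  set G : E → ℝ → ℝ≥0∞ := fun y s => ‖fderiv ℝ φ (y + (s * t) • v) v‖ₑ with hG_def
  have hG : Measurable (uncurry G) := by
    borelize F
    have h1 : Measurable fun z : E => fderiv ℝ φ z v := measurable_fderiv_apply_const ℝ φ v
    have h2 : Continuous fun p : E × ℝ => p.1 + (p.2 * t) • v := by fun_prop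
    exact (h1.comp h2.measurable).enorm
  calc ∫⁻ y in (Ω' : Set E), ‖FunctionSpaces.diffQuot v t φ y‖ₑ ^ q ∂μ
      ≤ ∫⁻ y in (Ω' : Set E), (∫⁻ s, G y s ∂ν) ^ q ∂μ := by
        refine setLIntegral_mono' Ω'.isOpen.measurableSet fun y hy => ?_
        exact ENNReal.rpow_le_rpow (enorm_diffQuot_le_lintegral Ω.isOpen hφ (hseg y hy)) hq0
    _ ≤ ∫⁻ s, ∫⁻ y in (Ω' : Set E), G y s ^ q ∂μ ∂ν := lintegral_rpow_lintegral_le hG hq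
    _ ≤ ∫⁻ s, ∫⁻ y in (Ω : Set E), ‖fderiv ℝ φ y v‖ₑ ^ q ∂μ ∂ν := by
        refine setLIntegral_mono' measurableSet_Ioc fun s hs => ?_
        exact setLIntegral_comp_add_le μ Ω'.isOpen.measurableSet
          (fun y hy => hseg y hy s (Ioc_subset_Icc_self hs)) (fun z => ‖fderiv ℝ φ z v‖ₑ ^ q)
    _ = ∫⁻ y in (Ω : Set E), ‖fderiv ℝ φ y v‖ₑ ^ q ∂μ := by
        rw [lintegral_const, measure_univ, mul_one]

omit [NormedSpace ℝ E] [NormedSpace ℝ F] [FiniteDimensional ℝ E] [CompleteSpace F] in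
/-- Translates of a.e. strongly measurable functions. [folklore] -/
theorem aestronglyMeasurable_comp_add (μ : Measure E) [μ.IsAddRightInvariant] {Ω Ω' : Opens E}
    {f : E → F} (hf : AEStronglyMeasurable f (μ.restrict (Ω : Set E))) {w : E}
    (hΩ : ∀ y ∈ (Ω' : Set E), y + w ∈ (Ω : Set E)) :
    AEStronglyMeasurable (fun y => f (y + w)) (μ.restrict (Ω' : Set E)) := by
  set e : E → E := fun y => y + w with he
  have himg : e '' (Ω' : Set E) ⊆ (Ω : Set E) := by
    rintro _ ⟨y, hy, rfl⟩
    exact hΩ y hy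
  have hpre : e ⁻¹' (e '' (Ω' : Set E)) = (Ω' : Set E) :=
    (add_left_injective w).preimage_image _
  have hmp : MeasurePreserving e (μ.restrict (e ⁻¹' (e '' (Ω' : Set E))))
      (μ.restrict (e '' (Ω' : Set E))) :=
    (measurePreserving_add_right μ w).restrict_preimage_emb (measurableEmbedding_addRight w) _
  rw [hpre] at hmp
  exact (hf.mono_measure (Measure.restrict_mono_set μ himg)).comp_measurePreserving hmp

omit [FiniteDimensional ℝ E] [CompleteSpace F] in
/-- The crude bound `‖D^t_v h‖_{L^p(Ω')} ≤ |t|⁻¹ · 2 ‖h‖_{L^p(Ω)}` for `Ω' ⊆ Ω`, `Ω' + t v ⊆ Ω`.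
[folklore] -/
theorem eLpNorm_diffQuot_le_two_mul (μ : Measure E) [μ.IsAddRightInvariant] {Ω Ω' : Opens E}
    {p : ℝ≥0∞} (hp : 1 ≤ p) {h : E → F} (hh : AEStronglyMeasurable h (μ.restrict (Ω : Set E)))
    (hle : Ω' ≤ Ω) {v : E} {t : ℝ} (hΩ : ∀ y ∈ (Ω' : Set E), y + t • v ∈ (Ω : Set E)) :
    eLpNorm (FunctionSpaces.diffQuot v t h) p (μ.restrict (Ω' : Set E)) ≤
      ‖t⁻¹‖ₑ * (2 * eLpNorm h p (μ.restrict (Ω : Set E))) := by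
  have e : FunctionSpaces.diffQuot v t h = t⁻¹ • ((fun y => h (y + t • v)) - h) := by
    funext y; simp [FunctionSpaces.diffQuot]
  rw [e, eLpNorm_const_smul]
  gcongr
  have h1 : AEStronglyMeasurable (fun y => h (y + t • v)) (μ.restrict (Ω' : Set E)) :=
    aestronglyMeasurable_comp_add μ hh hΩ
  have h2 : AEStronglyMeasurable h (μ.restrict (Ω' : Set E)) :=
    hh.mono_measure (Measure.restrict_mono_set μ hle)
  calc eLpNorm ((fun y => h (y + t • v)) - h) p (μ.restrict (Ω' : Set E))
      ≤ eLpNorm (fun y => h (y + t • v)) p (μ.restrict (Ω' : Set E)) +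
          eLpNorm h p (μ.restrict (Ω' : Set E)) := eLpNorm_sub_le h1 h2 hp
    _ ≤ eLpNorm h p (μ.restrict (Ω : Set E)) + eLpNorm h p (μ.restrict (Ω : Set E)) :=
        add_le_add (eLpNorm_comp_add_le μ h p hΩ) (eLpNorm_mono_measure h (Measure.restrict_mono_set μ hle))
    _ = 2 * eLpNorm h p (μ.restrict (Ω : Set E)) := by rw [two_mul]

variable {H : Type*} [NormedAddCommGroup H] [InnerProductSpace ℝ H] [FiniteDimensional ℝ H]
  [MeasurableSpace H] [BorelSpace H]

omit [MeasurableSpace E] [BorelSpace E] [FiniteDimensional ℝ E] in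
/-- **Evans §5.8.2, Theorem 3 (i) (difference quotients are bounded by the derivative)**: for
`f ∈ W^{1,p}(Ω)` with weak derivative `g`, `1 ≤ p < ∞`, and a pair `Ω' ⊆ Ω` such that the segments
`[y, y + t v]`, `y ∈ Ω'`, lie in `Ω`: `‖D^t_v f‖_{L^p(Ω')} ≤ ‖g v‖_{L^p(Ω)}`. Proof: the smooth case
(`lintegral_enorm_diffQuot_rpow_le_of_contDiffOn`) and Meyers–Serrin density in `W^{1,p}(Ω)`
(`meyers_serrin_holds`), the error terms being `2|t|⁻¹ ‖f - φₙ‖_{L^p(Ω)}` and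
`‖(g - Dφₙ) v‖_{L^p(Ω)} → 0`. [cite: Evans2010, §5.8.2 Theorem 3 (i)] -/
theorem eLpNorm_diffQuot_le (μ : Measure H) [μ.IsAddHaarMeasure] {Ω Ω' : Opens H} {p : ℝ≥0∞}
    (hp : 1 ≤ p) (hp' : p ≠ ⊤) {f : H → F} {g : H → H →L[ℝ] F} (hf : MemSobolevDomain 1 p Ω μ f)
    (hg : HasWeakFDerivOn Ω μ f g) {v : H} {t : ℝ}
    (hseg : ∀ y ∈ (Ω' : Set H), ∀ s ∈ Icc (0:ℝ) 1, y + (s * t) • v ∈ (Ω : Set H)) :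
    eLpNorm (FunctionSpaces.diffQuot v t f) p (μ.restrict (Ω' : Set H)) ≤
      eLpNorm (fun y => g y v) p (μ.restrict (Ω : Set H)) := by
  by_cases ht : t = 0
  · have : FunctionSpaces.diffQuot v t f = 0 := by funext y; simp [FunctionSpaces.diffQuot, ht]
    rw [this, eLpNorm_zero]; exact bot_le
  have hp0 : p ≠ 0 := (lt_of_lt_of_le zero_lt_one hp).ne'
  set q : ℝ := p.toReal with hq_def
  have hq : 1 ≤ q := by
    rw [hq_def, ← ENNReal.toReal_one]
    exact (ENNReal.toReal_le_toReal ENNReal.one_ne_top hp').2 hp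
  have hle : Ω' ≤ Ω := fun y hy => by simpa using hseg y hy 0 ⟨le_rfl, zero_le_one⟩
  have hΩt : ∀ y ∈ (Ω' : Set H), y + t • v ∈ (Ω : Set H) := fun y hy => by
    simpa using hseg y hy 1 ⟨zero_le_one, le_rfl⟩
  -- Meyers–Serrin approximation
  obtain ⟨φ, hφs, hφt⟩ := meyers_serrin_holds Ω hp hp' μ hf
  have hfm : AEStronglyMeasurable f (μ.restrict (Ω : Set H)) := hf.memLp.aestronglyMeasurable
  have hφm : ∀ n, AEStronglyMeasurable (φ n) (μ.restrict (Ω : Set H)) := fun n =>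
    (hφs n).continuousOn.aestronglyMeasurable Ω.isOpen.measurableSet
  -- the weak derivative of `f - φ n` and the norm decomposition
  set b := Module.finBasis ℝ H with hb
  have hwd : ∀ n, HasWeakFDerivOn Ω μ (f - φ n) (g - fderiv ℝ (φ n)) := fun n =>
    hg.sub (MeyersSerrin.hasWeakFDerivOn_of_contDiffOn (μ := μ) (hφs n))
  have hnorm : ∀ n, eSobolevDomainNorm 1 p Ω μ (f - φ n) =
      eLpNorm (f - φ n) p (μ.restrict (Ω : Set H)) +
        ∑ i, eLpNorm (fun x => (g - fderiv ℝ (φ n)) x (b i)) p (μ.restrict (Ω : Set H)) := fun n => by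
    rw [MeyersSerrin.eSobolevDomainNorm_succ_eq (hwd n)]
    simp only [eSobolevDomainNorm_zero, hb]
  -- error term 1: `‖f - φ n‖_{L^p(Ω)} → 0`
  have hE1 : Tendsto (fun n => eLpNorm (f - φ n) p (μ.restrict (Ω : Set H))) atTop (𝓝 0) := by
    refine tendsto_of_tendsto_of_tendsto_of_le_of_le tendsto_const_nhds hφt (fun n => bot_le) fun n => ?_
    rw [hnorm n]; exact le_self_add
  -- error term 2: `‖(g - Dφ n) v‖_{L^p(Ω)} → 0`
  have hE2 : Tendsto (fun n => eLpNorm (fun x => (g - fderiv ℝ (φ n)) x v) p (μ.restrict (Ω : Set H)))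
      atTop (𝓝 0) := by
    have hv : ∀ (x : H) (L : H →L[ℝ] F), L v = ∑ i, (b.repr v i) • L (b i) := fun x L => by
      conv_lhs => rw [← b.sum_repr v]
      rw [map_sum]
      exact Finset.sum_congr rfl fun i _ => by rw [map_smul]
    have hbound : ∀ n, eLpNorm (fun x => (g - fderiv ℝ (φ n)) x v) p (μ.restrict (Ω : Set H)) ≤
        ∑ i, ‖b.repr v i‖ₑ * eLpNorm (fun x => (g - fderiv ℝ (φ n)) x (b i)) p (μ.restrict (Ω : Set H)) := by
      intro n
      have e : (fun x => (g - fderiv ℝ (φ n)) x v) =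
          ∑ i, (fun x => (b.repr v i) • (g - fderiv ℝ (φ n)) x (b i)) := by
        funext x; rw [Finset.sum_apply]; exact hv x _
      rw [e]
      refine (eLpNorm_sum_le (fun i _ => ?_) hp).trans (le_of_eq (Finset.sum_congr rfl fun i _ => ?_))
      · exact ((ContinuousLinearMap.apply ℝ F (b i)).continuous.comp_aestronglyMeasurable
          (hwd n).locallyIntegrableOn_deriv.aestronglyMeasurable).const_smul _
      · rw [show (fun x => (b.repr v i) • (g - fderiv ℝ (φ n)) x (b i)) =
            (b.repr v i) • fun x => (g - fderiv ℝ (φ n)) x (b i) from rfl, eLpNorm_const_smul]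
    have hlim : Tendsto (fun n => ∑ i, ‖b.repr v i‖ₑ *
        eLpNorm (fun x => (g - fderiv ℝ (φ n)) x (b i)) p (μ.restrict (Ω : Set H))) atTop (𝓝 0) := by
      rw [← Finset.sum_const_zero]
      refine tendsto_finsetSum _ fun i _ => ?_
      rw [show (0 : ℝ≥0∞) = ‖b.repr v i‖ₑ * 0 by rw [mul_zero]]
      refine ENNReal.Tendsto.const_mul ?_ (Or.inr enorm_ne_top)
      refine tendsto_of_tendsto_of_tendsto_of_le_of_le tendsto_const_nhds hφt (fun n => bot_le) fun n => ?_
      rw [hnorm n]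
      exact (Finset.single_le_sum (f := fun i => eLpNorm (fun x => (g - fderiv ℝ (φ n)) x (b i)) p
        (μ.restrict (Ω : Set H))) (fun i _ => bot_le) (Finset.mem_univ i)).trans le_add_self
    exact tendsto_of_tendsto_of_tendsto_of_le_of_le tendsto_const_nhds hlim (fun n => bot_le) hbound
  -- the estimate for each `n`
  have hstep : ∀ n, eLpNorm (FunctionSpaces.diffQuot v t f) p (μ.restrict (Ω' : Set H)) ≤
      (‖t⁻¹‖ₑ * (2 * eLpNorm (f - φ n) p (μ.restrict (Ω : Set H))) +
        eLpNorm (fun x => (g - fderiv ℝ (φ n)) x v) p (μ.restrict (Ω : Set H))) +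
        eLpNorm (fun y => g y v) p (μ.restrict (Ω : Set H)) := by
    intro n
    -- split `D f = D (f - φ n) + D (φ n)`
    have hsplit : FunctionSpaces.diffQuot v t f =
        FunctionSpaces.diffQuot v t (f - φ n) + FunctionSpaces.diffQuot v t (φ n) := by
      rw [← diffQuot_add]; congr 1; abel
    have hm1 : AEStronglyMeasurable (FunctionSpaces.diffQuot v t (f - φ n)) (μ.restrict (Ω' : Set H)) := by
      have hfm' : AEStronglyMeasurable (f - φ n) (μ.restrict (Ω : Set H)) := hfm.sub (hφm n)
      have e : FunctionSpaces.diffQuot v t (f - φ n) = t⁻¹ • ((fun y => (f - φ n) (y + t • v)) - (f - φ n)) := by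
        funext y; simp [FunctionSpaces.diffQuot]
      rw [e]
      exact ((aestronglyMeasurable_comp_add μ hfm' hΩt).sub
        (hfm'.mono_measure (Measure.restrict_mono_set μ hle))).const_smul _
    have hm2 : AEStronglyMeasurable (FunctionSpaces.diffQuot v t (φ n)) (μ.restrict (Ω' : Set H)) := by
      have e : FunctionSpaces.diffQuot v t (φ n) = t⁻¹ • ((fun y => (φ n) (y + t • v)) - φ n) := by
        funext y; simp [FunctionSpaces.diffQuot]
      rw [e]
      exact ((aestronglyMeasurable_comp_add μ (hφm n) hΩt).sub
        ((hφm n).mono_measure (Measure.restrict_mono_set μ hle))).const_smul _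
    -- the smooth bound for `φ n`
    have hsmooth : eLpNorm (FunctionSpaces.diffQuot v t (φ n)) p (μ.restrict (Ω' : Set H)) ≤
        eLpNorm (fun y => fderiv ℝ (φ n) y v) p (μ.restrict (Ω : Set H)) := by
      have h1 := lintegral_enorm_diffQuot_rpow_le_of_contDiffOn μ ((hφs n).of_le (by exact_mod_cast le_top))
        hseg hq
      rw [eLpNorm_eq_lintegral_rpow_enorm_toReal hp0 hp', eLpNorm_eq_lintegral_rpow_enorm_toReal hp0 hp']
      exact ENNReal.rpow_le_rpow h1 (by positivity)
    -- `D(φ n) v = g v - (g - Dφ n) v`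
    have hgm : AEStronglyMeasurable (fun y => g y v) (μ.restrict (Ω : Set H)) :=
      (ContinuousLinearMap.apply ℝ F v).continuous.comp_aestronglyMeasurable
        hg.locallyIntegrableOn_deriv.aestronglyMeasurable
    have hdm : AEStronglyMeasurable (fun x => (g - fderiv ℝ (φ n)) x v) (μ.restrict (Ω : Set H)) :=
      (ContinuousLinearMap.apply ℝ F v).continuous.comp_aestronglyMeasurable
        (hwd n).locallyIntegrableOn_deriv.aestronglyMeasurable
    have hderiv : eLpNorm (fun y => fderiv ℝ (φ n) y v) p (μ.restrict (Ω : Set H)) ≤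
        eLpNorm (fun x => (g - fderiv ℝ (φ n)) x v) p (μ.restrict (Ω : Set H)) +
          eLpNorm (fun y => g y v) p (μ.restrict (Ω : Set H)) := by
      have e : (fun y => fderiv ℝ (φ n) y v) = (fun y => g y v) - fun x => (g - fderiv ℝ (φ n)) x v := by
        funext y; simp
      rw [e, add_comm]
      exact eLpNorm_sub_le hgm hdm hp
    calc eLpNorm (FunctionSpaces.diffQuot v t f) p (μ.restrict (Ω' : Set H))
        ≤ eLpNorm (FunctionSpaces.diffQuot v t (f - φ n)) p (μ.restrict (Ω' : Set H)) +
            eLpNorm (FunctionSpaces.diffQuot v t (φ n)) p (μ.restrict (Ω' : Set H)) := by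
          rw [hsplit]; exact eLpNorm_add_le hm1 hm2 hp
      _ ≤ ‖t⁻¹‖ₑ * (2 * eLpNorm (f - φ n) p (μ.restrict (Ω : Set H))) +
            (eLpNorm (fun x => (g - fderiv ℝ (φ n)) x v) p (μ.restrict (Ω : Set H)) +
              eLpNorm (fun y => g y v) p (μ.restrict (Ω : Set H))) :=
          add_le_add (eLpNorm_diffQuot_le_two_mul μ hp (hfm.sub (hφm n)) hle hΩt) (hsmooth.trans hderiv)
      _ = _ := by rw [add_assoc]
  -- pass to the limit `n → ∞`
  have hlim : Tendsto (fun n => (‖t⁻¹‖ₑ * (2 * eLpNorm (f - φ n) p (μ.restrict (Ω : Set H))) +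
      eLpNorm (fun x => (g - fderiv ℝ (φ n)) x v) p (μ.restrict (Ω : Set H))) +
        eLpNorm (fun y => g y v) p (μ.restrict (Ω : Set H))) atTop
      (𝓝 ((‖t⁻¹‖ₑ * (2 * 0) + 0) + eLpNorm (fun y => g y v) p (μ.restrict (Ω : Set H)))) := by
    refine Tendsto.add_const _ (Tendsto.add ?_ hE2)
    exact ENNReal.Tendsto.const_mul (ENNReal.Tendsto.const_mul hE1 (Or.inr ENNReal.ofNat_ne_top))
      (Or.inr enorm_ne_top)
  simp only [mul_zero, zero_add] at hlim
  exact ge_of_tendsto' hlim hstep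

end Bound



/-! ### Bounded difference quotients give a weak derivative (Evans §5.8.2, Theorem 3 (ii)) -/

section WeakLimit

variable {H : Type*} [NormedAddCommGroup H] [InnerProductSpace ℝ H] [FiniteDimensional ℝ H]
  [MeasurableSpace H] [BorelSpace H]

omit [FiniteDimensional ℝ H] [MeasurableSpace H] [BorelSpace H] in
/-- Difference quotients of a smooth compactly supported function are uniformly bounded by
`sup ‖Dφ‖ · ‖v‖` (mean value inequality). [folklore] -/
theorem norm_diffQuot_le_of_contDiff {φ : H → ℝ} (hφ : ContDiff ℝ 1 φ) (hφc : HasCompactSupport φ)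
    (v : H) : ∃ L : ℝ, 0 ≤ L ∧ ∀ (t : ℝ) (y : H), ‖FunctionSpaces.diffQuot v t φ y‖ ≤ L * ‖v‖ := by
  obtain ⟨L, hL⟩ := (hφc.fderiv (𝕜 := ℝ)).exists_bound_of_continuous (hφ.continuous_fderiv one_ne_zero)
  have hL0 : 0 ≤ L := (norm_nonneg _).trans (hL 0)
  refine ⟨L, hL0, fun t y => ?_⟩
  by_cases ht : t = 0
  · simp only [FunctionSpaces.diffQuot, ht, inv_zero, zero_smul, norm_zero]; positivity
  have hlip : LipschitzWith ⟨L, hL0⟩ φ :=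
    lipschitzWith_of_nnnorm_fderiv_le (hφ.differentiable one_ne_zero) fun x => by
      rw [← NNReal.coe_le_coe]; exact hL x
  rw [FunctionSpaces.diffQuot, norm_smul, norm_inv]
  have h1 : ‖φ (y + t • v) - φ y‖ ≤ L * ‖(y + t • v) - y‖ := by
    have := hlip.dist_le_mul (y + t • v) y
    rw [dist_eq_norm, dist_eq_norm] at this
    exact this
  rw [add_sub_cancel_left, norm_smul] at h1
  calc ‖t‖⁻¹ * ‖φ (y + t • v) - φ y‖ ≤ ‖t‖⁻¹ * (L * (‖t‖ * ‖v‖)) := by gcongr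
    _ = L * ‖v‖ := by
        have htn : ‖t‖ ≠ 0 := norm_ne_zero_iff.2 ht
        field_simp

/-- **Evans §5.8.2, Theorem 3 (ii) (bounded difference quotients give a weak derivative)**: let
`Ω' ⊆ Ω` be open sets with `μ Ω' < ∞`, `w` locally integrable on `Ω` and a.e. strongly measurable
there, `v` a vector and `tₙ → 0`, `tₙ ≠ 0`, with `Ω' + tₙ v ⊆ Ω`. If
`‖D^{tₙ}_v w‖_{L²(Ω')} ≤ C < ∞` for all `n`, then `w` has a weak derivative `w'` along the constant
field `v` on `Ω'` with `‖w'‖_{L²(Ω')} ≤ C`. Proof: a subsequence of `D^{tₙ}_v w` converges weakly in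
`L²(Ω')` to some `w'` (`exists_subseq_tendsto_integral_mul_of_lintegral_rpow_le'`); for a test
function `φ` on `Ω'`, `∫_{Ω'} (D^{-tₙ}_v φ) w = -∫_{Ω'} φ D^{tₙ}_v w` for `n` large (discrete
integration by parts), the left side tends to `∫ (∂_v φ) w` by dominated convergence and the right
side to `-∫ φ w'`. [cite: Evans2010, §5.8.2 Theorem 3 (ii)] -/
theorem exists_hasWeakDerivAlong_of_eLpNorm_diffQuot_le (μ : Measure H) [μ.IsAddHaarMeasure]
    {Ω Ω' : Opens H} (hle : Ω' ≤ Ω) (hfin : μ (Ω' : Set H) ≠ ⊤) {w : H → ℝ}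
    (hw : LocallyIntegrableOn w (Ω : Set H) μ) (hwm : AEStronglyMeasurable w (μ.restrict (Ω : Set H)))
    {v : H} {t : ℕ → ℝ} (ht0 : ∀ n, t n ≠ 0) (ht : Tendsto t atTop (𝓝 0))
    (hΩ : ∀ n, ∀ y ∈ (Ω' : Set H), y + t n • v ∈ (Ω : Set H)) {C : ℝ≥0∞} (hC : C ≠ ⊤)
    (hbd : ∀ n, eLpNorm (FunctionSpaces.diffQuot v (t n) w) 2 (μ.restrict (Ω' : Set H)) ≤ C) :
    ∃ w' : H → ℝ, MemLp w' 2 (μ.restrict (Ω' : Set H)) ∧ eLpNorm w' 2 (μ.restrict (Ω' : Set H)) ≤ C ∧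
      HasWeakDerivAlong Ω' μ (fun _ => v) w w' := by
  haveI : IsFiniteMeasure (μ.restrict (Ω' : Set H)) := ⟨by rwa [Measure.restrict_apply_univ, lt_top_iff_ne_top]⟩
  set f : ℕ → H → ℝ := fun n => FunctionSpaces.diffQuot v (t n) w with hf_def
  have hfm : ∀ n, AEStronglyMeasurable (f n) (μ.restrict (Ω' : Set H)) := fun n => by
    have e : f n = (t n)⁻¹ • ((fun y => w (y + t n • v)) - w) := by
      funext y; simp [hf_def, FunctionSpaces.diffQuot]
    rw [e]
    exact ((aestronglyMeasurable_comp_add μ hwm (hΩ n)).sub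
      (hwm.mono_measure (Measure.restrict_mono_set μ hle))).const_smul _
  -- the `L²` bound in `lintegral` form
  have h2 : (2 : ℝ≥0∞).toReal = 2 := by norm_num
  have hbd' : ∀ n, ∫⁻ x, ‖f n x‖ₑ ^ (2:ℝ) ∂(μ.restrict (Ω' : Set H)) ≤ C ^ (2:ℝ) := by
    intro n
    have h := hbd n
    rw [eLpNorm_eq_lintegral_rpow_enorm_toReal two_ne_zero ENNReal.ofNat_ne_top, h2, one_div,
      ENNReal.rpow_inv_le_iff (by norm_num : (0:ℝ) < 2)] at h
    exact h
  obtain ⟨σ, hσ, g, hgm, hgbd, hweak⟩ :=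
    exists_subseq_tendsto_integral_mul_of_lintegral_rpow_le' (μ := μ.restrict (Ω' : Set H))
      Real.HolderConjugate.two_two hfm (ENNReal.rpow_ne_top_of_nonneg (by norm_num) hC) hbd'
  have hof : ENNReal.ofReal 2 = 2 := by norm_num
  rw [hof] at hgm
  refine ⟨g, hgm, ?_, ?_⟩
  · rw [eLpNorm_eq_lintegral_rpow_enorm_toReal two_ne_zero ENNReal.ofNat_ne_top, h2, one_div,
      ENNReal.rpow_inv_le_iff (by norm_num : (0:ℝ) < 2)]
    exact hgbd
  -- the weak derivative identity
  have hgint : IntegrableOn g (Ω' : Set H) μ := hgm.integrable (by norm_num)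
  have hgi : LocallyIntegrableOn g (Ω' : Set H) μ := hgint.locallyIntegrableOn
  have hwΩ' : LocallyIntegrableOn w (Ω' : Set H) μ := hw.mono_set hle
  refine ⟨hwΩ', hgi, fun φ hφ => ?_⟩
  simp only [HasWeakDerivAlong.divergence_const_field, zero_mul, add_zero, smul_eq_mul]
  -- a compact cushion around the support of `φ` inside `Ω'`
  set K : Set H := tsupport φ with hK
  have hKc : IsCompact K := hφ.hasCompactSupport
  obtain ⟨δ, hδ, hKδ⟩ := hKc.exists_cthickening_subset_open Ω'.isOpen hφ.tsupport_subset
  have hKδc : IsCompact (cthickening δ K) := hKc.cthickening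
  -- the subsequence of steps still tends to `0`, and is eventually `δ`-small
  have htσ : Tendsto (fun n => t (σ n)) atTop (𝓝 0) := ht.comp hσ.tendsto_atTop
  have hsmall : ∀ᶠ n in atTop, ‖t (σ n) • v‖ < δ := by
    have : Tendsto (fun n => ‖t (σ n) • v‖) atTop (𝓝 0) := by
      have := (htσ.smul_const v).norm
      simpa using this
    exact (tendsto_order.1 this).2 δ hδ
  have hshift : ∀ {s : ℝ}, ‖s • v‖ < δ → ∀ y ∈ K, y + s • v ∈ (Ω' : Set H) := fun {s} hs y hy => by
    apply hKδ
    refine Metric.mem_cthickening_of_dist_le (y + s • v) y δ K hy ?_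
    rw [dist_eq_norm, add_sub_cancel_left]
    exact hs.le
  -- integrability of the tested products
  have hint : IntegrableOn (fun y => φ y • w y) (Ω' : Set H) μ :=
    integrableOn_smul_of_tsupport_subset hφ.contDiff.continuous hφ.hasCompactSupport
      hφ.tsupport_subset hwΩ'
  have hint' : ∀ n, IntegrableOn (fun y => φ y • w (y + t n • v)) (Ω' : Set H) μ := fun n =>
    integrableOn_smul_of_tsupport_subset hφ.contDiff.continuous hφ.hasCompactSupport
      hφ.tsupport_subset (locallyIntegrableOn_comp_add μ hw (hΩ n))
  -- discrete integration by parts, for `n` large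
  have hibp : ∀ᶠ n in atTop, ∫ y in (Ω' : Set H), (FunctionSpaces.diffQuot v (-(t (σ n))) φ y) * w y ∂μ =
      -∫ y in (Ω' : Set H), φ y * f (σ n) y ∂μ := by
    filter_upwards [hsmall] with n hn
    have h := setIntegral_diffQuot_neg_smul_eq μ (Ω := Ω') (A := K) (k := φ) (g := w) (v := v)
      (t := t (σ n)) (subset_tsupport φ) hφ.tsupport_subset (hshift hn) hint (hint' (σ n))
    simpa only [smul_eq_mul] using h
  -- left-hand side: dominated convergence
  obtain ⟨L, hL0, hL⟩ := norm_diffQuot_le_of_contDiff (hφ.contDiff.of_le (by exact_mod_cast le_top))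
    hφ.hasCompactSupport v
  have hφd : Differentiable ℝ φ := hφ.contDiff.differentiable (by simp)
  have hLHS : Tendsto (fun n => ∫ y in (Ω' : Set H), (FunctionSpaces.diffQuot v (-(t (σ n))) φ y) * w y ∂μ)
      atTop (𝓝 (∫ y in (Ω' : Set H), (fderiv ℝ φ y v) * w y ∂μ)) := by
    refine tendsto_integral_filter_of_dominated_convergence
      (fun y => (cthickening δ K).indicator (fun y => L * ‖v‖ * ‖w y‖) y) ?_ ?_ ?_ ?_
    · refine Eventually.of_forall fun n => ?_
      have hc : Continuous fun y => FunctionSpaces.diffQuot v (-(t (σ n))) φ y := by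
        have hφc : Continuous φ := hφ.contDiff.continuous
        simp only [FunctionSpaces.diffQuot]
        fun_prop
      exact hc.aestronglyMeasurable.mul (hwm.mono_measure (Measure.restrict_mono_set μ hle))
    · filter_upwards [hsmall] with n hn
      refine Eventually.of_forall fun y => ?_
      by_cases hy : y ∈ cthickening δ K
      · rw [indicator_of_mem hy, norm_mul]
        exact mul_le_mul_of_nonneg_right (hL _ _) (norm_nonneg _)
      · rw [indicator_of_notMem hy]
        have h0 : FunctionSpaces.diffQuot v (-(t (σ n))) φ y = 0 := by
          have hy1 : y ∉ K := fun h => hy (Metric.self_subset_cthickening K h)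
          have hy2 : y + (-(t (σ n))) • v ∉ K := by
            intro h
            apply hy
            have hmem := Metric.mem_cthickening_of_dist_le y (y + (-(t (σ n))) • v) δ K h ?_
            · exact hmem
            rw [dist_eq_norm, sub_add_cancel_left, norm_neg, neg_smul, norm_neg]
            exact hn.le
          rw [FunctionSpaces.diffQuot, image_eq_zero_of_notMem_tsupport hy1,
            image_eq_zero_of_notMem_tsupport hy2, sub_zero, smul_zero]
        rw [h0, zero_mul, norm_zero]
    · have hwK : IntegrableOn w (cthickening δ K) μ := hwΩ'.integrableOn_compact_subset hKδ hKδc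
      have : IntegrableOn (fun y => L * ‖v‖ * ‖w y‖) (cthickening δ K) μ := (hwK.norm.const_mul _)
      exact (this.integrable_indicator hKδc.measurableSet).mono_measure Measure.restrict_le_self
    · refine Eventually.of_forall fun y => ?_
      have hderiv : HasLineDerivAt ℝ φ (fderiv ℝ φ y v) y v := (hφd y).hasFDerivAt.hasLineDerivAt v
      have hslope := HasDerivAt.tendsto_slope_zero hderiv
      simp only [zero_add, zero_smul, add_zero] at hslope
      have hseq : Tendsto (fun n => -(t (σ n))) atTop (𝓝[≠] 0) := by
        refine tendsto_nhdsWithin_iff.2 ⟨by simpa using htσ.neg, Eventually.of_forall fun n => ?_⟩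
        simpa using ht0 (σ n)
      have := (hslope.comp hseq).mul_const (w y)
      simpa [FunctionSpaces.diffQuot, Function.comp_def] using this
  -- right-hand side: weak convergence
  have hφ2 : MemLp φ (ENNReal.ofReal 2) (μ.restrict (Ω' : Set H)) := by
    rw [hof]
    exact (hφ.contDiff.continuous.memLp_top_of_hasCompactSupport hφ.hasCompactSupport _).mono_exponent
      le_top
  have hRHS : Tendsto (fun n => -∫ y in (Ω' : Set H), φ y * f (σ n) y ∂μ) atTop
      (𝓝 (-∫ y in (Ω' : Set H), φ y * g y ∂μ)) := by
    have h := (hweak φ hφ2).neg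
    simp_rw [mul_comm (f (σ _) _), mul_comm (g _)] at h
    exact h
  -- conclude
  have hlim2 : Tendsto (fun n => ∫ y in (Ω' : Set H), (FunctionSpaces.diffQuot v (-(t (σ n))) φ y) * w y ∂μ)
      atTop (𝓝 (-∫ y in (Ω' : Set H), φ y * g y ∂μ)) :=
    hRHS.congr' (hibp.mono fun n hn => hn.symm)
  exact tendsto_nhds_unique hLHS hlim2

end WeakLimit


end Literature.Analysis.FunctionSpaces

end
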